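import Summits.CriticalPhenomena.SAWScalingLimit.Theses.SAWExpectedSignature
import Literature.Probability.RandomPlanarGeometry.SLEExistenceNeEightHolds
import Literature.Probability.RandomPlanarGeometry.CritPercSLESimplePathHolds
import Literature.Probability.RandomPlanarGeometry.CaratheodoryHalfPlaneProofs
import Literature.Probability.RandomPlanarGeometry.LocalMartingaleProofs
import Literature.Probability.RandomPlanarGeometry.ConformalRestrictionProofs
import Literature.Probability.RandomPlanarGeometry.SimpleCurves
import HarnessLib.Audit

/-!
# Line `signature-moment-seam` for crux `MomentsIdentifySLE` (stmt-CriticalPhenomena-5888, route SAWExpectedSignature)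

IDEA. Cut the moment-method identification "a simple, pinned, finite-variation law ν carrying the limits of ALL lattice
expected-signature coefficients of the critical SAW is the chordal SLE(8/3) law" along its three classical seams and
then one level further, into seven registered stubs:

* piece `SigLimitIsSLE` (VALUE IDENTIFICATION, lattice / conformal content) ⇐ `stub_sleYoungRegular` (α: lattice
  convergence certifies Young-regularity of the SLE(8/3) law — finite `q`-variation moments of all orders, integrable
  coefficients) + `stub_valueIsSLE` (β: every lattice coefficient limit equals the SLE expectation — level-2
  antisymmetric part = integrated Schramm left-passage law at κ = 8/3, level 3 Werness, level n Boedihardjo–Ni–Qian;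
  THE HARD STUB);
* piece `SLESigDeterminacy` (EXPECTED-SIGNATURE DETERMINACY at SLE) ⇐ `stub_expSigRadius` (ρ: infinite radius of
  convergence of the SLE(8/3) expected signature — OPEN, cf. Boedihardjo–Diehl–Mezzarobba–Ni 2021) +
  `stub_determinacyOfRadius` (pure Chevyrev–Lyons criterion, Ann. Probab. 44 (2016) Prop. 6.1);
* piece `SimpleLawFromSigLaw` (SIGNATURE UNIQUENESS FOR SIMPLE PINNED LAWS, support) ⇐ PROVED `sleSimplePinned`
  (Rohde–Schramm Thm 6.1 in the tree) + `stub_coeffMeasurable` (Borel measurability of `V_r` and of the coefficients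
  on the strata) + `stub_sigInjOn` (Boedihardjo–Geng–Lyons–Yang 2016 Thm 1.1: simple curves are tree-reduced, so the
  signature is injective on simple pinned finite-variation classes) + `stub_measure_eq_of_injOn` (π–λ + Lusin–Souslin).

§0 re-declares the three pieces verbatim from `Cruxes/MomentsIdentifySLE/Split.lean` (crux work-files are not
importable modules on the farm; the split glue `MomentsIdentifySLE_of_subs` proved there is INLINED in §2 so that the
only theorem of this file concluding the crux under hypotheses is `MomentsIdentifySLE_of`). §1 holds the stubs
and the three piece compositions (each sorry-free). §2 is the kernel-checked composition
`MomentsIdentifySLE_of : α → β → ρ → criterion → measurability → injectivity → transfer → MomentsIdentifySLE`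
(route decl BY NAME) and `MomentsIdentifySLE_of_stubs`. Sorries live ONLY inside the seven `stub_*`.

Disproof used: none relevant (no `Cruxes/MomentsIdentifySLE/Disproof.lean` exists at registration time).
Dead lines avoided: v1 pieces with SLE signature-integrability as a free-standing claim over ALL Dobrushin domains
(junk at marked prime ends into which ∂D spirals) — here Young-regularity of the SLE law is an OUTPUT of lattice
convergence (α) and a HYPOTHESIS downstream (ρ, criterion, piece 3).
-/

namespace Summit.CriticalPhenomena.SAWScalingLimit.Cruxes.MomentsIdentifySLE.Split

open Summit.CriticalPhenomena.SAWScalingLimit.Theses.SAWExpectedSignature (MomentsIdentifySLE)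

open scoped BigOperators Topology Manifold Classical MeasureTheory ProbabilityTheory Matrix InnerProductSpace ComplexConjugate ContinuousMap
open Filter Set Function TopologicalSpace MeasureTheory

/-- piece 1 (crux): if every lattice expected-signature coefficient converges, the limits are the
expected signature of the chordal SLE(8/3) law of `(D; a, b)`, which is Young-regular. -/
def SigLimitIsSLE : Prop :=
  ∀ (D : Literature.Probability.RandomPlanarGeometry.DobrushinDomain) (a b : ℝ → Literature.Probability.LatticeModels.Site 2), Literature.Probability.RandomPlanarGeometry.SAW.IsEndpointApprox D a b → let pv : ℝ → Literature.Probability.RandomPlanarGeometry.Curve ℂ → ENNReal := fun p c => ⨆ π : ℕ × {u : ℕ → unitInterval // Monotone u}, ∑ i ∈ Finset.range π.1, edist (c (π.2.1 (i + 1))) (c (π.2.1 i)) ^ p; let sig : List (Fin 2) → Literature.Probability.RandomPlanarGeometry.Curve ℂ → ℝ := fun w c => limUnder Filter.atTop (fun n : ℕ => ∑ k ∈ (Finset.univ : Finset (Fin w.length → Fin (2 ^ n))).filter (fun k => StrictMono k), ∏ j : Fin w.length, (if w.get j = 0 then Complex.re else Complex.im) (c (Set.projIcc (0 : ℝ) 1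 zero_le_one ((((k j : ℕ) : ℝ) + 1) / 2 ^ n)) - c (Set.projIcc (0 : ℝ) 1 zero_le_one (((k j : ℕ) : ℝ) / 2 ^ n)))); let rep : Literature.Probability.RandomPlanarGeometry.CurveClass ℂ → Literature.Probability.RandomPlanarGeometry.Curve ℂ := fun x => (Literature.Probability.RandomPlanarGeometry.CurveClass.surjective_mk x).choose; let poly : (δ : ℝ) → Literature.Probability.RandomPlanarGeometry.SAW.DomainSAW D.carrier δ (a δ) (b δ) → Literature.Probability.RandomPlanarGeometry.Curve ℂ := fun δ γ => ⟨γ.walk.toCurve (Literature.Probability.LatticeModels.meshPoint δ)⟩; ∀ μ : MeasureTheory.Measure (Literature.Probability.RandomPlanarGeometry.CurveClass ℂ), Literature.Probability.RandomPlanarGeometry.IsSLELaw ((8 : NNReal) / 3) D μ → ∀ s : List (Fin 2) → ℝ, (∀ w : List (Fin 2), Filter.Tendsto (fun δ => ∫ γ, sig w (poly δ γ) ∂(Literature.Probability.RandomPlanarGeometry.SAW.law D.carrier δ (a δ) (b δ))) (nhdsWithin 0 (Set.Ioi 0)) (nhds (s w))) → ∃ q : ℝ, 1 ≤ q ∧ q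 < 2 ∧ (∀ n : ℕ, ∫⁻ x, pv q (rep x) ^ (n : ℝ) ∂μ ≠ ⊤) ∧ ∀ w : List (Fin 2), MeasureTheory.Integrable (fun x => sig w (rep x)) μ ∧ ∫ x, sig w (rep x) ∂μ = s w

/-- piece 2 (crux): expected-signature determinacy anchored at a Young-regular SLE(8/3) law — equal
expected signatures (with finite variation moments of all orders on both sides) force equal joint laws of
the signature coefficients. -/
def SLESigDeterminacy : Prop :=
  ∀ (D : Literature.Probability.RandomPlanarGeometry.DobrushinDomain), let pv : ℝ → Literature.Probability.RandomPlanarGeometry.Curve ℂ → ENNReal := fun p c => ⨆ π : ℕ × {u : ℕ → unitInterval // Monotone u}, ∑ i ∈ Finset.range π.1, edist (c (π.2.1 (i + 1))) (c (π.2.1 i)) ^ p; let sig : List (Fin 2) → Literature.Probability.RandomPlanarGeometry.Curve ℂ → ℝ := fun w c => limUnder Filter.atTop (fun n : ℕ => ∑ k ∈ (Finset.univ : Finset (Fin w.length → Fin (2 ^ n))).filter (fun k => StrictMono k), ∏ j : Fin w.length, (if w.get j = 0 then Complex.re else Complex.im) (c (Set.projIcc (0 : ℝ) 1 zero_le_one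 ((((k j : ℕ) : ℝ) + 1) / 2 ^ n)) - c (Set.projIcc (0 : ℝ) 1 zero_le_one (((k j : ℕ) : ℝ) / 2 ^ n)))); let rep : Literature.Probability.RandomPlanarGeometry.CurveClass ℂ → Literature.Probability.RandomPlanarGeometry.Curve ℂ := fun x => (Literature.Probability.RandomPlanarGeometry.CurveClass.surjective_mk x).choose; ∀ (p q : ℝ), 1 ≤ p → p < 2 → 1 ≤ q → q < 2 → ∀ μ ν : MeasureTheory.Measure (Literature.Probability.RandomPlanarGeometry.CurveClass ℂ), Literature.Probability.RandomPlanarGeometry.IsSLELaw ((8 : NNReal) / 3) D μ → MeasureTheory.IsProbabilityMeasure ν → (∀ n : ℕ, ∫⁻ x, pv q (rep x) ^ (n : ℝ) ∂μ ≠ ⊤) → (∀ n : ℕ, ∫⁻ x, pv p (rep x) ^ (n : ℝ) ∂ν ≠ ⊤) → (∀ w : List (Fin 2), MeasureTheory.Integrable (fun x => sig w (rep x)) μ ∧ MeasureTheory.Integrable (fun x => sig w (rep x)) ν ∧ ∫ x, sig w (rep x) ∂ν = ∫ x, sig w (rep x) ∂μ) → ∀ (ws : List (List (Fin 2))) (F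 : BoundedContinuousFunction (Fin ws.length → ℝ) ℝ), ∫ x, F (fun i => sig (ws.get i) (rep x)) ∂ν = ∫ x, F (fun i => sig (ws.get i) (rep x)) ∂μ

/-- piece 3 (support): a simple law pinned at `a = D.pt 0` with finite variation moments whose signature
coefficients have the same joint law as under a Young-regular SLE(8/3) law of `D` is that law. -/
def SimpleLawFromSigLaw : Prop :=
  ∀ (D : Literature.Probability.RandomPlanarGeometry.DobrushinDomain), let pv : ℝ → Literature.Probability.RandomPlanarGeometry.Curve ℂ → ENNReal := fun p c => ⨆ π : ℕ × {u : ℕ → unitInterval // Monotone u}, ∑ i ∈ Finset.range π.1, edist (c (π.2.1 (i + 1))) (c (π.2.1 i)) ^ p; let sig : List (Fin 2) → Literature.Probability.RandomPlanarGeometry.Curve ℂ → ℝ := fun w c => limUnder Filter.atTop (fun n : ℕ => ∑ k ∈ (Finset.univ : Finset (Fin w.length → Fin (2 ^ n))).filter (fun k => StrictMono k), ∏ j : Fin w.length, (if w.get j = 0 then Complex.re else Complex.im) (c (Set.projIcc (0 : ℝ) 1 zero_le_one ((((k j : ℕ) : ℝ) + 1) / 2 ^ n)) - c (Set.projIcc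 (0 : ℝ) 1 zero_le_one (((k j : ℕ) : ℝ) / 2 ^ n)))); let rep : Literature.Probability.RandomPlanarGeometry.CurveClass ℂ → Literature.Probability.RandomPlanarGeometry.Curve ℂ := fun x => (Literature.Probability.RandomPlanarGeometry.CurveClass.surjective_mk x).choose; ∀ (p q : ℝ), 1 ≤ p → p < 2 → 1 ≤ q → q < 2 → ∀ μ ν : MeasureTheory.Measure (Literature.Probability.RandomPlanarGeometry.CurveClass ℂ), Literature.Probability.RandomPlanarGeometry.IsSLELaw ((8 : NNReal) / 3) D μ → MeasureTheory.IsProbabilityMeasure ν → (∀ n : ℕ, ∫⁻ x, pv q (rep x) ^ (n : ℝ) ∂μ ≠ ⊤) → (∀ n : ℕ, ∫⁻ x, pv p (rep x) ^ (n : ℝ) ∂ν ≠ ⊤) → ν (Literature.Probability.RandomPlanarGeometry.CurveClass.simple)ᶜ = 0 → ν {x | x.source ≠ D.pt 0} = 0 → (∀ (ws : List (List (Fin 2))) (F : BoundedContinuousFunction (Fin ws.length → ℝ) ℝ), ∫ x, F (fun i => sig (ws.get i) (rep x)) ∂ν = ∫ x, F (fun i => sig (ws.get i) (rep x)) ∂μ)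 → ν = μ


end Summit.CriticalPhenomena.SAWScalingLimit.Cruxes.MomentsIdentifySLE.Split

namespace Summit.CriticalPhenomena.SAWScalingLimit.Cruxes.MomentsIdentifySLE.SignatureMomentSeam

open Summit.CriticalPhenomena.SAWScalingLimit.Theses.SAWExpectedSignature (MomentsIdentifySLE)
open Summit.CriticalPhenomena.SAWScalingLimit.Cruxes.MomentsIdentifySLE.Split
open scoped BigOperators Topology Classical MeasureTheory ProbabilityTheory ENNReal NNReal
open Filter Set Function TopologicalSpace MeasureTheory

/-! ## §1a  piece `SigLimitIsSLE` — stubs α, β and the composition -/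

/-- stub α — lattice convergence of all expected-signature coefficients certifies Young-regularity of the chordal
SLE(8/3) law of `(D; a, b)`: finite `q`-variation moments of all orders for some `1 ≤ q < 2` and integrable signature
coefficients (Werness 2012 Thm 1.1 gives `q > 4/3` in smooth geometry; size L–XL). -/
theorem stub_sleYoungRegular :
    ∀ (D : Literature.Probability.RandomPlanarGeometry.DobrushinDomain) (a b : ℝ → Literature.Probability.LatticeModels.Site 2), Literature.Probability.RandomPlanarGeometry.SAW.IsEndpointApprox D a b → let pv : ℝ → Literature.Probability.RandomPlanarGeometry.Curve ℂ → ENNReal := fun p c => ⨆ π : ℕ × {u : ℕ → unitInterval // Monotone u}, ∑ i ∈ Finset.range π.1, edist (c (π.2.1 (i + 1))) (c (π.2.1 i)) ^ p; let sig : List (Fin 2) → Literature.Probability.RandomPlanarGeometry.Curve ℂ → ℝ := fun w c => limUnder Filter.atTop (fun n : ℕ => ∑ k ∈ (Finset.univ : Finset (Fin w.length → Fin (2 ^ n))).filter (fun k => StrictMono k), ∏ j : Fin w.length, (if w.get j = 0 then Complex.re else Complex.im) (c (Set.projIcc (0 : ℝ) 1 zero_le_one ((((k j : ℕ) : ℝ)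 + 1) / 2 ^ n)) - c (Set.projIcc (0 : ℝ) 1 zero_le_one (((k j : ℕ) : ℝ) / 2 ^ n)))); let rep : Literature.Probability.RandomPlanarGeometry.CurveClass ℂ → Literature.Probability.RandomPlanarGeometry.Curve ℂ := fun x => (Literature.Probability.RandomPlanarGeometry.CurveClass.surjective_mk x).choose; let poly : (δ : ℝ) → Literature.Probability.RandomPlanarGeometry.SAW.DomainSAW D.carrier δ (a δ) (b δ) → Literature.Probability.RandomPlanarGeometry.Curve ℂ := fun δ γ => ⟨γ.walk.toCurve (Literature.Probability.LatticeModels.meshPoint δ)⟩; (∃ s : List (Fin 2) → ℝ, ∀ w : List (Fin 2), Filter.Tendsto (fun δ => ∫ γ, sig w (poly δ γ) ∂(Literature.Probability.RandomPlanarGeometry.SAW.law D.carrier δ (a δ) (b δ))) (nhdsWithin 0 (Set.Ioi 0)) (nhds (s w))) → ∀ μ : MeasureTheory.Measure (Literature.Probability.RandomPlanarGeometry.CurveClass ℂ), Literature.Probability.RandomPlanarGeometry.IsSLELaw ((8 : NNReal) / 3) D μ → ∃ q : ℝ, 1 ≤ q ∧ q < 2 ∧ (∀ n : ℕ, ∫⁻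 x, pv q (rep x) ^ (n : ℝ) ∂μ ≠ ⊤) ∧ ∀ w : List (Fin 2), MeasureTheory.Integrable (fun x => sig w (rep x)) μ := by
  sorry

/-- stub β — VALUE IDENTIFICATION (the conformal content, size XL, the hardest stub): for a Young-regular SLE(8/3)
law `μ`, any limit of a lattice coefficient `E_δ[S_w]` equals `∫ S_w dμ` (Lawler–Schramm–Werner 2004 Prediction 1
at the level of signature moments; level 2 = integrated Schramm formula, Schramm 2001; Werness 2012; Kennedy 2002
numerics). -/
theorem stub_valueIsSLE :
    ∀ (D : Literature.Probability.RandomPlanarGeometry.DobrushinDomain) (a b : ℝ → Literature.Probability.LatticeModels.Site 2), Literature.Probability.RandomPlanarGeometry.SAW.IsEndpointApprox D a b → let pv : ℝ → Literature.Probability.RandomPlanarGeometry.Curve ℂ → ENNReal := fun p c => ⨆ π : ℕ × {u : ℕ → unitInterval // Monotone u}, ∑ i ∈ Finset.range π.1, edist (c (π.2.1 (i + 1))) (c (π.2.1 i)) ^ p; let sig : List (Fin 2) → Literature.Probability.RandomPlanarGeometry.Curve ℂ → ℝ := fun w c => limUnder Filter.atTop (fun n : ℕ => ∑ k ∈ (Finset.univ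 : Finset (Fin w.length → Fin (2 ^ n))).filter (fun k => StrictMono k), ∏ j : Fin w.length, (if w.get j = 0 then Complex.re else Complex.im) (c (Set.projIcc (0 : ℝ) 1 zero_le_one ((((k j : ℕ) : ℝ) + 1) / 2 ^ n)) - c (Set.projIcc (0 : ℝ) 1 zero_le_one (((k j : ℕ) : ℝ) / 2 ^ n)))); let rep : Literature.Probability.RandomPlanarGeometry.CurveClass ℂ → Literature.Probability.RandomPlanarGeometry.Curve ℂ := fun x => (Literature.Probability.RandomPlanarGeometry.CurveClass.surjective_mk x).choose; let poly : (δ : ℝ) → Literature.Probability.RandomPlanarGeometry.SAW.DomainSAW D.carrier δ (a δ) (b δ) → Literature.Probability.RandomPlanarGeometry.Curve ℂ := fun δ γ => ⟨γ.walk.toCurve (Literature.Probability.LatticeModels.meshPoint δ)⟩; ∀ μ : MeasureTheory.Measure (Literature.Probability.RandomPlanarGeometry.CurveClass ℂ), Literature.Probability.RandomPlanarGeometry.IsSLELaw ((8 : NNReal) / 3) D μ → ∀ q : ℝ, 1 ≤ q → q < 2 → (∀ n : ℕ, ∫⁻ x, pv q (rep x) ^ (n : ℝ) ∂μ ≠ ⊤)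 → (∀ w : List (Fin 2), MeasureTheory.Integrable (fun x => sig w (rep x)) μ) → ∀ (w : List (Fin 2)) (s : ℝ), Filter.Tendsto (fun δ => ∫ γ, sig w (poly δ γ) ∂(Literature.Probability.RandomPlanarGeometry.SAW.law D.carrier δ (a δ) (b δ))) (nhdsWithin 0 (Set.Ioi 0)) (nhds s) → ∫ x, sig w (rep x) ∂μ = s := by
  sorry

/-- Composition of piece 1: α and β give `SigLimitIsSLE` by name. -/
theorem SigLimitIsSLE_of :
    (∀ (D : Literature.Probability.RandomPlanarGeometry.DobrushinDomain) (a b : ℝ → Literature.Probability.LatticeModels.Site 2), Literature.Probability.RandomPlanarGeometry.SAW.IsEndpointApprox D a b → let pv : ℝ → Literature.Probability.RandomPlanarGeometry.Curve ℂ → ENNReal := fun p c => ⨆ π : ℕ × {u : ℕ → unitInterval // Monotone u}, ∑ i ∈ Finset.range π.1, edist (c (π.2.1 (i + 1))) (c (π.2.1 i)) ^ p; let sig : List (Fin 2) → Literature.Probability.RandomPlanarGeometry.Curve ℂ → ℝ := fun w c => limUnder Filter.atTop (fun n : ℕ => ∑ k ∈ (Finset.univ : Finset (Fin w.length → Fin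 (2 ^ n))).filter (fun k => StrictMono k), ∏ j : Fin w.length, (if w.get j = 0 then Complex.re else Complex.im) (c (Set.projIcc (0 : ℝ) 1 zero_le_one ((((k j : ℕ) : ℝ) + 1) / 2 ^ n)) - c (Set.projIcc (0 : ℝ) 1 zero_le_one (((k j : ℕ) : ℝ) / 2 ^ n)))); let rep : Literature.Probability.RandomPlanarGeometry.CurveClass ℂ → Literature.Probability.RandomPlanarGeometry.Curve ℂ := fun x => (Literature.Probability.RandomPlanarGeometry.CurveClass.surjective_mk x).choose; let poly : (δ : ℝ) → Literature.Probability.RandomPlanarGeometry.SAW.DomainSAW D.carrier δ (a δ) (b δ) → Literature.Probability.RandomPlanarGeometry.Curve ℂ := fun δ γ => ⟨γ.walk.toCurve (Literature.Probability.LatticeModels.meshPoint δ)⟩; (∃ s : List (Fin 2) → ℝ, ∀ w : List (Fin 2), Filter.Tendsto (fun δ => ∫ γ, sig w (poly δ γ) ∂(Literature.Probability.RandomPlanarGeometry.SAW.law D.carrier δ (a δ) (b δ))) (nhdsWithin 0 (Set.Ioi 0)) (nhds (s w))) → ∀ μ : MeasureTheory.Measure (Literature.Probability.RandomPlanarGeometry.CurveClass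 ℂ), Literature.Probability.RandomPlanarGeometry.IsSLELaw ((8 : NNReal) / 3) D μ → ∃ q : ℝ, 1 ≤ q ∧ q < 2 ∧ (∀ n : ℕ, ∫⁻ x, pv q (rep x) ^ (n : ℝ) ∂μ ≠ ⊤) ∧ ∀ w : List (Fin 2), MeasureTheory.Integrable (fun x => sig w (rep x)) μ) →
    (∀ (D : Literature.Probability.RandomPlanarGeometry.DobrushinDomain) (a b : ℝ → Literature.Probability.LatticeModels.Site 2), Literature.Probability.RandomPlanarGeometry.SAW.IsEndpointApprox D a b → let pv : ℝ → Literature.Probability.RandomPlanarGeometry.Curve ℂ → ENNReal := fun p c => ⨆ π : ℕ × {u : ℕ → unitInterval // Monotone u}, ∑ i ∈ Finset.range π.1, edist (c (π.2.1 (i + 1))) (c (π.2.1 i)) ^ p; let sig : List (Fin 2) → Literature.Probability.RandomPlanarGeometry.Curve ℂ → ℝ := fun w c => limUnder Filter.atTop (fun n : ℕ => ∑ k ∈ (Finset.univ : Finset (Fin w.length → Fin (2 ^ n))).filter (fun k => StrictMono k), ∏ j : Fin w.length, (if w.get j = 0 then Complex.re else Complex.im) (c (Set.projIcc (0 : ℝ)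 1 zero_le_one ((((k j : ℕ) : ℝ) + 1) / 2 ^ n)) - c (Set.projIcc (0 : ℝ) 1 zero_le_one (((k j : ℕ) : ℝ) / 2 ^ n)))); let rep : Literature.Probability.RandomPlanarGeometry.CurveClass ℂ → Literature.Probability.RandomPlanarGeometry.Curve ℂ := fun x => (Literature.Probability.RandomPlanarGeometry.CurveClass.surjective_mk x).choose; let poly : (δ : ℝ) → Literature.Probability.RandomPlanarGeometry.SAW.DomainSAW D.carrier δ (a δ) (b δ) → Literature.Probability.RandomPlanarGeometry.Curve ℂ := fun δ γ => ⟨γ.walk.toCurve (Literature.Probability.LatticeModels.meshPoint δ)⟩; ∀ μ : MeasureTheory.Measure (Literature.Probability.RandomPlanarGeometry.CurveClass ℂ), Literature.Probability.RandomPlanarGeometry.IsSLELaw ((8 : NNReal) / 3) D μ → ∀ q : ℝ, 1 ≤ q → q < 2 → (∀ n : ℕ, ∫⁻ x, pv q (rep x) ^ (n : ℝ) ∂μ ≠ ⊤) → (∀ w : List (Fin 2), MeasureTheory.Integrable (fun x => sig w (rep x)) μ) → ∀ (w : List (Fin 2)) (s : ℝ), Filter.Tendsto (fun δ => ∫ γ,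 sig w (poly δ γ) ∂(Literature.Probability.RandomPlanarGeometry.SAW.law D.carrier δ (a δ) (b δ))) (nhdsWithin 0 (Set.Ioi 0)) (nhds s) → ∫ x, sig w (rep x) ∂μ = s) →
    SigLimitIsSLE := by
  intro hα hβ D a b hab
  dsimp only
  intro μ hμ s hs
  have hα' := hα D a b hab
  dsimp only at hα'
  obtain ⟨q, hq1, hq2, hmom, hint⟩ := hα' ⟨s, hs⟩ μ hμ
  have hβ' := hβ D a b hab
  dsimp only at hβ'
  exact ⟨q, hq1, hq2, hmom, fun w => ⟨hint w, hβ' μ hμ q hq1 hq2 hmom hint w (s w) (hs w)⟩⟩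

/-! ## §1b  piece `SLESigDeterminacy` — stubs ρ, criterion and the composition -/

/-- stub ρ — infinite radius of convergence of the expected signature of a Young-regular SLE(8/3) law (the
Chevyrev–Lyons hypothesis; OPEN — Boedihardjo–Diehl–Mezzarobba–Ni 2021 prove FINITE radius for planar Brownian motion
stopped on a circle; size XL). -/
theorem stub_expSigRadius :
    ∀ (D : Literature.Probability.RandomPlanarGeometry.DobrushinDomain), let pv : ℝ → Literature.Probability.RandomPlanarGeometry.Curve ℂ → ENNReal := fun p c => ⨆ π : ℕ × {u : ℕ → unitInterval // Monotone u}, ∑ i ∈ Finset.range π.1, edist (c (π.2.1 (i + 1))) (c (π.2.1 i)) ^ p; let sig : List (Fin 2) → Literature.Probability.RandomPlanarGeometry.Curve ℂ → ℝ := fun w c => limUnder Filter.atTop (fun n : ℕ => ∑ k ∈ (Finset.univ : Finset (Fin w.length → Fin (2 ^ n))).filter (fun k => StrictMono k), ∏ j : Fin w.length, (if w.get j = 0 then Complex.re else Complex.im) (c (Set.projIcc (0 : ℝ) 1 zero_le_one ((((k j : ℕ) : ℝ) + 1) / 2 ^ n)) - c (Set.projIcc (0 : ℝ) 1 zero_le_one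 (((k j : ℕ) : ℝ) / 2 ^ n)))); let rep : Literature.Probability.RandomPlanarGeometry.CurveClass ℂ → Literature.Probability.RandomPlanarGeometry.Curve ℂ := fun x => (Literature.Probability.RandomPlanarGeometry.CurveClass.surjective_mk x).choose; ∀ (q : ℝ), 1 ≤ q → q < 2 → ∀ μ : MeasureTheory.Measure (Literature.Probability.RandomPlanarGeometry.CurveClass ℂ), Literature.Probability.RandomPlanarGeometry.IsSLELaw ((8 : NNReal) / 3) D μ → (∀ n : ℕ, ∫⁻ x, pv q (rep x) ^ (n : ℝ) ∂μ ≠ ⊤) → (∀ w : List (Fin 2), MeasureTheory.Integrable (fun x => sig w (rep x)) μ) → ∀ r : ℝ, 0 < r → Summable (fun n : ℕ => r ^ n * ⨆ w : {w : List (Fin 2) // w.length = n}, |∫ x, sig w.1 (rep x) ∂μ|) := by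
  sorry

/-- stub (criterion) — Chevyrev–Lyons determinacy in pure form: finite variation moments of all orders on both sides,
equal expected signatures, infinite radius of convergence ⇒ equal joint laws of the coefficients (Chevyrev–Lyons,
Ann. Probab. 44 (2016), Prop. 6.1 / Cor. 6.5; known in print, size L). -/
theorem stub_determinacyOfRadius :
    let pv : ℝ → Literature.Probability.RandomPlanarGeometry.Curve ℂ → ENNReal := fun p c => ⨆ π : ℕ × {u : ℕ → unitInterval // Monotone u}, ∑ i ∈ Finset.range π.1, edist (c (π.2.1 (i + 1))) (c (π.2.1 i)) ^ p; let sig : List (Fin 2) → Literature.Probability.RandomPlanarGeometry.Curve ℂ → ℝ := fun w c => limUnder Filter.atTop (fun n : ℕ => ∑ k ∈ (Finset.univ : Finset (Fin w.length → Fin (2 ^ n))).filter (fun k => StrictMono k), ∏ j : Fin w.length, (if w.get j = 0 then Complex.re else Complex.im) (c (Set.projIcc (0 : ℝ) 1 zero_le_one ((((k j : ℕ) : ℝ) + 1) / 2 ^ n)) - c (Set.projIcc (0 : ℝ) 1 zero_le_one (((k j : ℕ) : ℝ) / 2 ^ n)))); let rep : Literature.Probability.RandomPlanarGeometry.CurveClass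 ℂ → Literature.Probability.RandomPlanarGeometry.Curve ℂ := fun x => (Literature.Probability.RandomPlanarGeometry.CurveClass.surjective_mk x).choose; ∀ (p q : ℝ), 1 ≤ p → p < 2 → 1 ≤ q → q < 2 → ∀ μ ν : MeasureTheory.Measure (Literature.Probability.RandomPlanarGeometry.CurveClass ℂ), MeasureTheory.IsProbabilityMeasure μ → MeasureTheory.IsProbabilityMeasure ν → (∀ n : ℕ, ∫⁻ x, pv q (rep x) ^ (n : ℝ) ∂μ ≠ ⊤) → (∀ n : ℕ, ∫⁻ x, pv p (rep x) ^ (n : ℝ) ∂ν ≠ ⊤) → (∀ w : List (Fin 2), MeasureTheory.Integrable (fun x => sig w (rep x)) μ ∧ MeasureTheory.Integrable (fun x => sig w (rep x)) ν ∧ ∫ x, sig w (rep x) ∂ν = ∫ x, sig w (rep x) ∂μ) → (∀ r : ℝ, 0 < r → Summable (fun n : ℕ => r ^ n * ⨆ w : {w : List (Fin 2) // w.length = n}, |∫ x, sig w.1 (rep x) ∂μ|)) → ∀ (ws : List (List (Fin 2))) (F : BoundedContinuousFunction (Fin ws.length → ℝ) ℝ), ∫ x, F (fun i => sig (ws.get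 i) (rep x)) ∂ν = ∫ x, F (fun i => sig (ws.get i) (rep x)) ∂μ := by
  sorry

/-- Composition of piece 2: ρ and the criterion give `SLESigDeterminacy` by name. -/
theorem SLESigDeterminacy_of :
    (∀ (D : Literature.Probability.RandomPlanarGeometry.DobrushinDomain), let pv : ℝ → Literature.Probability.RandomPlanarGeometry.Curve ℂ → ENNReal := fun p c => ⨆ π : ℕ × {u : ℕ → unitInterval // Monotone u}, ∑ i ∈ Finset.range π.1, edist (c (π.2.1 (i + 1))) (c (π.2.1 i)) ^ p; let sig : List (Fin 2) → Literature.Probability.RandomPlanarGeometry.Curve ℂ → ℝ := fun w c => limUnder Filter.atTop (fun n : ℕ => ∑ k ∈ (Finset.univ : Finset (Fin w.length → Fin (2 ^ n))).filter (fun k => StrictMono k), ∏ j : Fin w.length, (if w.get j = 0 then Complex.re else Complex.im) (c (Set.projIcc (0 : ℝ) 1 zero_le_one ((((k j : ℕ) : ℝ) + 1) / 2 ^ n)) - c (Set.projIcc (0 : ℝ) 1 zero_le_one (((k j : ℕ) : ℝ) / 2 ^ n)))); let rep : Literature.Probability.RandomPlanarGeometry.CurveClass ℂ → Literature.Probability.RandomPlanarGeometry.Curve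 ℂ := fun x => (Literature.Probability.RandomPlanarGeometry.CurveClass.surjective_mk x).choose; ∀ (q : ℝ), 1 ≤ q → q < 2 → ∀ μ : MeasureTheory.Measure (Literature.Probability.RandomPlanarGeometry.CurveClass ℂ), Literature.Probability.RandomPlanarGeometry.IsSLELaw ((8 : NNReal) / 3) D μ → (∀ n : ℕ, ∫⁻ x, pv q (rep x) ^ (n : ℝ) ∂μ ≠ ⊤) → (∀ w : List (Fin 2), MeasureTheory.Integrable (fun x => sig w (rep x)) μ) → ∀ r : ℝ, 0 < r → Summable (fun n : ℕ => r ^ n * ⨆ w : {w : List (Fin 2) // w.length = n}, |∫ x, sig w.1 (rep x) ∂μ|)) →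
    (let pv : ℝ → Literature.Probability.RandomPlanarGeometry.Curve ℂ → ENNReal := fun p c => ⨆ π : ℕ × {u : ℕ → unitInterval // Monotone u}, ∑ i ∈ Finset.range π.1, edist (c (π.2.1 (i + 1))) (c (π.2.1 i)) ^ p; let sig : List (Fin 2) → Literature.Probability.RandomPlanarGeometry.Curve ℂ → ℝ := fun w c => limUnder Filter.atTop (fun n : ℕ => ∑ k ∈ (Finset.univ : Finset (Fin w.length → Fin (2 ^ n))).filter (fun k => StrictMono k), ∏ j : Fin w.length, (if w.get j = 0 then Complex.re else Complex.im) (c (Set.projIcc (0 : ℝ) 1 zero_le_one ((((k j : ℕ) : ℝ) + 1) / 2 ^ n)) - c (Set.projIcc (0 : ℝ) 1 zero_le_one (((k j : ℕ) : ℝ) / 2 ^ n)))); let rep : Literature.Probability.RandomPlanarGeometry.CurveClass ℂ → Literature.Probability.RandomPlanarGeometry.Curve ℂ := fun x => (Literature.Probability.RandomPlanarGeometry.CurveClass.surjective_mk x).choose; ∀ (p q : ℝ), 1 ≤ p → p < 2 → 1 ≤ q → q < 2 → ∀ μ ν : MeasureTheory.Measure (Literature.Probability.RandomPlanarGeometry.CurveClass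 ℂ), MeasureTheory.IsProbabilityMeasure μ → MeasureTheory.IsProbabilityMeasure ν → (∀ n : ℕ, ∫⁻ x, pv q (rep x) ^ (n : ℝ) ∂μ ≠ ⊤) → (∀ n : ℕ, ∫⁻ x, pv p (rep x) ^ (n : ℝ) ∂ν ≠ ⊤) → (∀ w : List (Fin 2), MeasureTheory.Integrable (fun x => sig w (rep x)) μ ∧ MeasureTheory.Integrable (fun x => sig w (rep x)) ν ∧ ∫ x, sig w (rep x) ∂ν = ∫ x, sig w (rep x) ∂μ) → (∀ r : ℝ, 0 < r → Summable (fun n : ℕ => r ^ n * ⨆ w : {w : List (Fin 2) // w.length = n}, |∫ x, sig w.1 (rep x) ∂μ|)) → ∀ (ws : List (List (Fin 2))) (F : BoundedContinuousFunction (Fin ws.length → ℝ) ℝ), ∫ x, F (fun i => sig (ws.get i) (rep x)) ∂ν = ∫ x, F (fun i => sig (ws.get i) (rep x)) ∂μ) →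
    SLESigDeterminacy := by
  intro hρ hc D
  dsimp only
  intro p q hp1 hp2 hq1 hq2 μ ν hμ hν hmomμ hmomν heq
  have hρ' := hρ D
  dsimp only at hρ'
  have hrad := hρ' q hq1 hq2 μ hμ hmomμ (fun w => (heq w).1)
  haveI : Fact Literature.Probability.Process.isProjectiveLimit_preWienerMeasure :=
    ⟨Literature.Probability.RandomPlanarGeometry.isProjectiveLimit_preWienerMeasure_holds⟩
  have hμP : MeasureTheory.IsProbabilityMeasure μ := hμ.isProbabilityMeasure
  dsimp only at hc
  exact hc p q hp1 hp2 hq1 hq2 μ ν hμP hν hmomμ hmomν heq hrad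

/-! ## §1c  piece `SimpleLawFromSigLaw` — proved SLE facts, stubs (measurability, injectivity, transfer), composition -/

/-- PROVED (tree facts): a chordal SLE(8/3) law of `D` is a probability law carried by simple classes issued
from `a = D.pt 0` (Rohde–Schramm 2005, Thm 6.1; Lawler 2005, §6.3). -/
theorem sleSimplePinned (D : Literature.Probability.RandomPlanarGeometry.DobrushinDomain) (μ : MeasureTheory.Measure (Literature.Probability.RandomPlanarGeometry.CurveClass ℂ))
    (hμ : Literature.Probability.RandomPlanarGeometry.IsSLELaw ((8 : NNReal) / 3) D μ) :
    MeasureTheory.IsProbabilityMeasure μ ∧ μ (Literature.Probability.RandomPlanarGeometry.CurveClass.simple)ᶜ = 0 ∧ μ {x | x.source ≠ D.pt 0} = 0 := by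
  haveI : Fact Literature.Probability.Process.isProjectiveLimit_preWienerMeasure :=
    ⟨Literature.Probability.RandomPlanarGeometry.isProjectiveLimit_preWienerMeasure_holds⟩
  have hκ0 : (0 : NNReal) < 8 / 3 := by positivity
  have hκ4 : (8 : NNReal) / 3 ≤ 4 := by
    rw [div_le_iff₀ (by norm_num : (0 : NNReal) < 3)]; norm_num
  refine ⟨hμ.isProbabilityMeasure, ?_, ?_⟩
  · have h := hμ.ae_simple Literature.Probability.RandomPlanarGeometry.ae_isSimpleTrace_sleTrace_of_le_four_holds
      Literature.Probability.RandomPlanarGeometry.CurveClass.measurableSet_simple_holds hκ0 hκ4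
    exact mem_ae_iff.1 (Filter.eventually_mem_set.1 (h.mono fun γ hγ => hγ.1))
  · have h := hμ.ae_endpoints Literature.Probability.RandomPlanarGeometry.JordanDomain.mapsTo_boundaryExtension_holds
    exact ae_iff.1 (h.mono fun γ hγ => hγ.1)

/-- Null-set bookkeeping (pure measure theory): a law carried by `S`, pinned at `z` and a.e. of finite
`r`-variation for one `r ∈ [1, 2)` gives full measure to the stratum
`S ∩ {src = z} ∩ {∃ r ∈ [1,2), V_r ≠ ⊤}`. [folklore] -/
theorem measure_compl_strata_null {X : Type*} [MeasurableSpace X] (ρ : MeasureTheory.Measure X) {S : Set X}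
    {src : X → ℂ} {z : ℂ} (V : ℝ → X → ℝ≥0∞) {r : ℝ} (hr1 : 1 ≤ r) (hr2 : r < 2)
    (hS : ρ Sᶜ = 0) (hP : ρ {x | src x ≠ z} = 0) (hR : ∀ᵐ x ∂ρ, V r x < ⊤) :
    ρ {x | x ∈ S ∧ src x = z ∧ ∃ r : ℝ, 1 ≤ r ∧ r < 2 ∧ V r x ≠ ⊤}ᶜ = 0 := by
  have hS' : ∀ᵐ x ∂ρ, x ∈ S := Filter.eventually_mem_set.2 (mem_ae_iff.2 hS)
  have hP' : ∀ᵐ x ∂ρ, src x = z := by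
    rw [ae_iff]
    exact hP
  rw [← mem_ae_iff, ← Filter.eventually_mem_set]
  filter_upwards [hS', hP', hR] with x h1 h2 h3
  exact ⟨h1, h2, r, hr1, hr2, h3.ne⟩

/-- stub (analytic preliminaries, size M) — `x ↦ V_r(rep x)` is Borel (reparametrisation-invariant lower
semicontinuous class function); the strata `A_z = simple ∩ {source = z} ∩ {∃ r < 2, V_r < ∞}` are Borel; every
signature coefficient restricted to `A_z` is Borel (Lyons–Young continuity on `{V_r ≤ K}`). -/
theorem stub_coeffMeasurable :
    let pv : ℝ → Literature.Probability.RandomPlanarGeometry.Curve ℂ → ENNReal := fun p c => ⨆ π : ℕ × {u : ℕ → unitInterval // Monotone u}, ∑ i ∈ Finset.range π.1, edist (c (π.2.1 (i + 1))) (c (π.2.1 i)) ^ p; let sig : List (Fin 2) → Literature.Probability.RandomPlanarGeometry.Curve ℂ → ℝ := fun w c => limUnder Filter.atTop (fun n : ℕ => ∑ k ∈ (Finset.univ : Finset (Fin w.length → Fin (2 ^ n))).filter (fun k => StrictMono k), ∏ j : Fin w.length, (if w.get j = 0 then Complex.re else Complex.im) (c (Set.projIcc (0 : ℝ) 1 zero_le_one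 ((((k j : ℕ) : ℝ) + 1) / 2 ^ n)) - c (Set.projIcc (0 : ℝ) 1 zero_le_one (((k j : ℕ) : ℝ) / 2 ^ n)))); let rep : Literature.Probability.RandomPlanarGeometry.CurveClass ℂ → Literature.Probability.RandomPlanarGeometry.Curve ℂ := fun x => (Literature.Probability.RandomPlanarGeometry.CurveClass.surjective_mk x).choose; (∀ r : ℝ, 1 ≤ r → r < 2 → Measurable (fun x : Literature.Probability.RandomPlanarGeometry.CurveClass ℂ => pv r (rep x))) ∧ ∀ z : ℂ, MeasurableSet {x : Literature.Probability.RandomPlanarGeometry.CurveClass ℂ | x ∈ Literature.Probability.RandomPlanarGeometry.CurveClass.simple ∧ x.source = z ∧ ∃ r : ℝ, 1 ≤ r ∧ r < 2 ∧ pv r (rep x) ≠ ⊤} ∧ ∀ w : List (Fin 2), Measurable (Set.restrict {x : Literature.Probability.RandomPlanarGeometry.CurveClass ℂ | x ∈ Literature.Probability.RandomPlanarGeometry.CurveClass.simple ∧ x.source = z ∧ ∃ r : ℝ, 1 ≤ r ∧ r < 2 ∧ pv r (rep x) ≠ ⊤} (fun x => sig w (rep x))) := by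
  sorry

/-- stub (uniqueness of signature for simple curves, size L–XL) — on `A_z` the coefficient family `(S_w)_w` is
injective (Boedihardjo–Geng–Lyons–Yang, Adv. Math. 293 (2016), Thm 1.1 + simple curves are tree-reduced;
Boedihardjo–Ni–Qian, J. Funct. Anal. 267 (2014)). -/
theorem stub_sigInjOn :
    let pv : ℝ → Literature.Probability.RandomPlanarGeometry.Curve ℂ → ENNReal := fun p c => ⨆ π : ℕ × {u : ℕ → unitInterval // Monotone u}, ∑ i ∈ Finset.range π.1, edist (c (π.2.1 (i + 1))) (c (π.2.1 i)) ^ p; let sig : List (Fin 2) → Literature.Probability.RandomPlanarGeometry.Curve ℂ → ℝ := fun w c => limUnder Filter.atTop (fun n : ℕ => ∑ k ∈ (Finset.univ : Finset (Fin w.length → Fin (2 ^ n))).filter (fun k => StrictMono k), ∏ j : Fin w.length, (if w.get j = 0 then Complex.re else Complex.im) (c (Set.projIcc (0 : ℝ) 1 zero_le_one ((((k j : ℕ) : ℝ) + 1) / 2 ^ n)) - c (Set.projIcc (0 : ℝ) 1 zero_le_one (((k j : ℕ) : ℝ) / 2 ^ n)))); let rep : Literature.Probability.RandomPlanarGeometry.CurveClass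 ℂ → Literature.Probability.RandomPlanarGeometry.Curve ℂ := fun x => (Literature.Probability.RandomPlanarGeometry.CurveClass.surjective_mk x).choose; ∀ z : ℂ, Set.InjOn (fun x : Literature.Probability.RandomPlanarGeometry.CurveClass ℂ => fun w : List (Fin 2) => sig w (rep x)) {x : Literature.Probability.RandomPlanarGeometry.CurveClass ℂ | x ∈ Literature.Probability.RandomPlanarGeometry.CurveClass.simple ∧ x.source = z ∧ ∃ r : ℝ, 1 ≤ r ∧ r < 2 ∧ pv r (rep x) ≠ ⊤} := by
  sorry

/-- stub (descriptive measure theory, size M) — two probability laws concentrated on a Borel set on which a countable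
family of Borel real functions is injective, with equal finite-dimensional joint laws, are equal (π–λ on `ℝ^ℕ` +
Lusin–Souslin, `Measurable.measurableEmbedding` on the Polish space `CurveClass ℂ`). -/
theorem stub_measure_eq_of_injOn :
    ∀ (f : List (Fin 2) → Literature.Probability.RandomPlanarGeometry.CurveClass ℂ → ℝ) (A : Set (Literature.Probability.RandomPlanarGeometry.CurveClass ℂ)), MeasurableSet A → (∀ w : List (Fin 2), Measurable (A.restrict (f w))) → Set.InjOn (fun x => fun w => f w x) A → ∀ μ ν : MeasureTheory.Measure (Literature.Probability.RandomPlanarGeometry.CurveClass ℂ), MeasureTheory.IsProbabilityMeasure μ → MeasureTheory.IsProbabilityMeasure ν → μ Aᶜ = 0 → ν Aᶜ = 0 → (∀ (ws : List (List (Fin 2))) (F : BoundedContinuousFunction (Fin ws.length → ℝ) ℝ), ∫ x, F (fun i => f (ws.get i) x) ∂ν = ∫ x, F (fun i => f (ws.get i) x) ∂μ) → ν = μ := by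
  sorry

/-- Composition of piece 3: the three stubs (and the proved `sleSimplePinned`) give `SimpleLawFromSigLaw` by name. -/
theorem SimpleLawFromSigLaw_of :
    (let pv : ℝ → Literature.Probability.RandomPlanarGeometry.Curve ℂ → ENNReal := fun p c => ⨆ π : ℕ × {u : ℕ → unitInterval // Monotone u}, ∑ i ∈ Finset.range π.1, edist (c (π.2.1 (i + 1))) (c (π.2.1 i)) ^ p; let sig : List (Fin 2) → Literature.Probability.RandomPlanarGeometry.Curve ℂ → ℝ := fun w c => limUnder Filter.atTop (fun n : ℕ => ∑ k ∈ (Finset.univ : Finset (Fin w.length → Fin (2 ^ n))).filter (fun k => StrictMono k), ∏ j : Fin w.length, (if w.get j = 0 then Complex.re else Complex.im) (c (Set.projIcc (0 : ℝ) 1 zero_le_one ((((k j : ℕ) : ℝ) + 1) / 2 ^ n)) - c (Set.projIcc (0 : ℝ) 1 zero_le_one (((k j : ℕ) : ℝ) / 2 ^ n)))); let rep : Literature.Probability.RandomPlanarGeometry.CurveClass ℂ → Literature.Probability.RandomPlanarGeometry.Curve ℂ := fun x => (Literature.Probability.RandomPlanarGeometry.CurveClass.surjective_mk x).choose; (∀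 r : ℝ, 1 ≤ r → r < 2 → Measurable (fun x : Literature.Probability.RandomPlanarGeometry.CurveClass ℂ => pv r (rep x))) ∧ ∀ z : ℂ, MeasurableSet {x : Literature.Probability.RandomPlanarGeometry.CurveClass ℂ | x ∈ Literature.Probability.RandomPlanarGeometry.CurveClass.simple ∧ x.source = z ∧ ∃ r : ℝ, 1 ≤ r ∧ r < 2 ∧ pv r (rep x) ≠ ⊤} ∧ ∀ w : List (Fin 2), Measurable (Set.restrict {x : Literature.Probability.RandomPlanarGeometry.CurveClass ℂ | x ∈ Literature.Probability.RandomPlanarGeometry.CurveClass.simple ∧ x.source = z ∧ ∃ r : ℝ, 1 ≤ r ∧ r < 2 ∧ pv r (rep x) ≠ ⊤} (fun x => sig w (rep x)))) →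
    (let pv : ℝ → Literature.Probability.RandomPlanarGeometry.Curve ℂ → ENNReal := fun p c => ⨆ π : ℕ × {u : ℕ → unitInterval // Monotone u}, ∑ i ∈ Finset.range π.1, edist (c (π.2.1 (i + 1))) (c (π.2.1 i)) ^ p; let sig : List (Fin 2) → Literature.Probability.RandomPlanarGeometry.Curve ℂ → ℝ := fun w c => limUnder Filter.atTop (fun n : ℕ => ∑ k ∈ (Finset.univ : Finset (Fin w.length → Fin (2 ^ n))).filter (fun k => StrictMono k), ∏ j : Fin w.length, (if w.get j = 0 then Complex.re else Complex.im) (c (Set.projIcc (0 : ℝ) 1 zero_le_one ((((k j : ℕ) : ℝ) + 1) / 2 ^ n)) - c (Set.projIcc (0 : ℝ) 1 zero_le_one (((k j : ℕ) : ℝ) / 2 ^ n)))); let rep : Literature.Probability.RandomPlanarGeometry.CurveClass ℂ → Literature.Probability.RandomPlanarGeometry.Curve ℂ := fun x => (Literature.Probability.RandomPlanarGeometry.CurveClass.surjective_mk x).choose; ∀ z : ℂ, Set.InjOn (fun x : Literature.Probability.RandomPlanarGeometry.CurveClass ℂ => fun w : List (Fin 2) => sig w (rep x)) {x : Literature.Probability.RandomPlanarGeometry.CurveClass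 ℂ | x ∈ Literature.Probability.RandomPlanarGeometry.CurveClass.simple ∧ x.source = z ∧ ∃ r : ℝ, 1 ≤ r ∧ r < 2 ∧ pv r (rep x) ≠ ⊤}) →
    (∀ (f : List (Fin 2) → Literature.Probability.RandomPlanarGeometry.CurveClass ℂ → ℝ) (A : Set (Literature.Probability.RandomPlanarGeometry.CurveClass ℂ)), MeasurableSet A → (∀ w : List (Fin 2), Measurable (A.restrict (f w))) → Set.InjOn (fun x => fun w => f w x) A → ∀ μ ν : MeasureTheory.Measure (Literature.Probability.RandomPlanarGeometry.CurveClass ℂ), MeasureTheory.IsProbabilityMeasure μ → MeasureTheory.IsProbabilityMeasure ν → μ Aᶜ = 0 → ν Aᶜ = 0 → (∀ (ws : List (List (Fin 2))) (F : BoundedContinuousFunction (Fin ws.length → ℝ) ℝ), ∫ x, F (fun i => f (ws.get i) x) ∂ν = ∫ x, F (fun i => f (ws.get i) x) ∂μ) → ν = μ) →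
    SimpleLawFromSigLaw := by
  intro hM hI hT D
  dsimp only
  intro p q hp1 hp2 hq1 hq2 μ ν hμ hν hmomμ hmomν hsimp hsrc hlaw
  dsimp only at hM hI
  obtain ⟨hpv, hA⟩ := hM
  obtain ⟨hμP, hμsimp, hμsrc⟩ := sleSimplePinned D μ hμ
  -- order-one variation moments: both laws are a.e. of finite variation
  have hmomμ1 := hmomμ 1
  have hmomν1 := hmomν 1
  simp only [Nat.cast_one, ENNReal.rpow_one] at hmomμ1 hmomν1
  have hfinμ := ae_lt_top (hpv q hq1 hq2) hmomμ1
  have hfinν := ae_lt_top (hpv p hp1 hp2) hmomν1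
  -- transfer along the injective coefficient map on the stratum `A_a`, `a = D.pt 0`
  refine hT _ _ (hA (D.pt 0)).1 (hA (D.pt 0)).2 (hI (D.pt 0)) μ ν hμP hν ?_ ?_ hlaw
  · exact measure_compl_strata_null μ _ hq1 hq2 hμsimp hμsrc hfinμ
  · exact measure_compl_strata_null ν _ hp1 hp2 hsimp hsrc hfinν

/-! ## §2  the line: seven stubs ⇒ the crux, BY NAME -/

/-! ### Registered stubs — name-keyed aliases of the seven stub statements (LITERAL copies) -/

namespace Registered

/-- name-keyed alias of the statement of `stub_sleYoungRegular` (the registrar matches hypotheses of `MomentsIdentifySLE_of` by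
these names). [folklore] -/
abbrev stub_sleYoungRegular : Prop :=
  ∀ (D : Literature.Probability.RandomPlanarGeometry.DobrushinDomain) (a b : ℝ → Literature.Probability.LatticeModels.Site 2), Literature.Probability.RandomPlanarGeometry.SAW.IsEndpointApprox D a b → let pv : ℝ → Literature.Probability.RandomPlanarGeometry.Curve ℂ → ENNReal := fun p c => ⨆ π : ℕ × {u : ℕ → unitInterval // Monotone u}, ∑ i ∈ Finset.range π.1, edist (c (π.2.1 (i + 1))) (c (π.2.1 i)) ^ p; let sig : List (Fin 2) → Literature.Probability.RandomPlanarGeometry.Curve ℂ → ℝ := fun w c => limUnder Filter.atTop (fun n : ℕ => ∑ k ∈ (Finset.univ : Finset (Fin w.length → Fin (2 ^ n))).filter (fun k => StrictMono k), ∏ j : Fin w.length, (if w.get j = 0 then Complex.re else Complex.im) (c (Set.projIcc (0 : ℝ) 1 zero_le_one ((((k j : ℕ) : ℝ) + 1) / 2 ^ n)) - c (Set.projIcc (0 : ℝ) 1 zero_le_one (((k j : ℕ) : ℝ) / 2 ^ n)))); let rep : Literature.Probability.RandomPlanarGeometry.CurveClass ℂ → Literature.Probability.RandomPlanarGeometry.Curve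 ℂ := fun x => (Literature.Probability.RandomPlanarGeometry.CurveClass.surjective_mk x).choose; let poly : (δ : ℝ) → Literature.Probability.RandomPlanarGeometry.SAW.DomainSAW D.carrier δ (a δ) (b δ) → Literature.Probability.RandomPlanarGeometry.Curve ℂ := fun δ γ => ⟨γ.walk.toCurve (Literature.Probability.LatticeModels.meshPoint δ)⟩; (∃ s : List (Fin 2) → ℝ, ∀ w : List (Fin 2), Filter.Tendsto (fun δ => ∫ γ, sig w (poly δ γ) ∂(Literature.Probability.RandomPlanarGeometry.SAW.law D.carrier δ (a δ) (b δ))) (nhdsWithin 0 (Set.Ioi 0)) (nhds (s w))) → ∀ μ : MeasureTheory.Measure (Literature.Probability.RandomPlanarGeometry.CurveClass ℂ), Literature.Probability.RandomPlanarGeometry.IsSLELaw ((8 : NNReal) / 3) D μ → ∃ q : ℝ, 1 ≤ q ∧ q < 2 ∧ (∀ n : ℕ, ∫⁻ x, pv q (rep x) ^ (n : ℝ) ∂μ ≠ ⊤) ∧ ∀ w : List (Fin 2), MeasureTheory.Integrable (fun x => sig w (rep x)) μ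

/-- name-keyed alias of the statement of `stub_valueIsSLE` (the registrar matches hypotheses of `MomentsIdentifySLE_of` by
these names). [folklore] -/
abbrev stub_valueIsSLE : Prop :=
  ∀ (D : Literature.Probability.RandomPlanarGeometry.DobrushinDomain) (a b : ℝ → Literature.Probability.LatticeModels.Site 2), Literature.Probability.RandomPlanarGeometry.SAW.IsEndpointApprox D a b → let pv : ℝ → Literature.Probability.RandomPlanarGeometry.Curve ℂ → ENNReal := fun p c => ⨆ π : ℕ × {u : ℕ → unitInterval // Monotone u}, ∑ i ∈ Finset.range π.1, edist (c (π.2.1 (i + 1))) (c (π.2.1 i)) ^ p; let sig : List (Fin 2) → Literature.Probability.RandomPlanarGeometry.Curve ℂ → ℝ := fun w c => limUnder Filter.atTop (fun n : ℕ => ∑ k ∈ (Finset.univ : Finset (Fin w.length → Fin (2 ^ n))).filter (fun k => StrictMono k), ∏ j : Fin w.length, (if w.get j = 0 then Complex.re else Complex.im) (c (Set.projIcc (0 : ℝ) 1 zero_le_one ((((k j : ℕ) : ℝ) + 1) / 2 ^ n)) - c (Set.projIcc (0 : ℝ) 1 zero_le_one (((k j : ℕ) : ℝ) / 2 ^ n))));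 let rep : Literature.Probability.RandomPlanarGeometry.CurveClass ℂ → Literature.Probability.RandomPlanarGeometry.Curve ℂ := fun x => (Literature.Probability.RandomPlanarGeometry.CurveClass.surjective_mk x).choose; let poly : (δ : ℝ) → Literature.Probability.RandomPlanarGeometry.SAW.DomainSAW D.carrier δ (a δ) (b δ) → Literature.Probability.RandomPlanarGeometry.Curve ℂ := fun δ γ => ⟨γ.walk.toCurve (Literature.Probability.LatticeModels.meshPoint δ)⟩; ∀ μ : MeasureTheory.Measure (Literature.Probability.RandomPlanarGeometry.CurveClass ℂ), Literature.Probability.RandomPlanarGeometry.IsSLELaw ((8 : NNReal) / 3) D μ → ∀ q : ℝ, 1 ≤ q → q < 2 → (∀ n : ℕ, ∫⁻ x, pv q (rep x) ^ (n : ℝ) ∂μ ≠ ⊤) → (∀ w : List (Fin 2), MeasureTheory.Integrable (fun x => sig w (rep x)) μ) → ∀ (w : List (Fin 2)) (s : ℝ), Filter.Tendsto (fun δ => ∫ γ, sig w (poly δ γ) ∂(Literature.Probability.RandomPlanarGeometry.SAW.law D.carrier δ (a δ) (b δ))) (nhdsWithin 0 (Set.Ioi 0)) (nhds s) → ∫ x,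 sig w (rep x) ∂μ = s

/-- name-keyed alias of the statement of `stub_expSigRadius` (the registrar matches hypotheses of `MomentsIdentifySLE_of` by
these names). [folklore] -/
abbrev stub_expSigRadius : Prop :=
  ∀ (D : Literature.Probability.RandomPlanarGeometry.DobrushinDomain), let pv : ℝ → Literature.Probability.RandomPlanarGeometry.Curve ℂ → ENNReal := fun p c => ⨆ π : ℕ × {u : ℕ → unitInterval // Monotone u}, ∑ i ∈ Finset.range π.1, edist (c (π.2.1 (i + 1))) (c (π.2.1 i)) ^ p; let sig : List (Fin 2) → Literature.Probability.RandomPlanarGeometry.Curve ℂ → ℝ := fun w c => limUnder Filter.atTop (fun n : ℕ => ∑ k ∈ (Finset.univ : Finset (Fin w.length → Fin (2 ^ n))).filter (fun k => StrictMono k), ∏ j : Fin w.length, (if w.get j = 0 then Complex.re else Complex.im) (c (Set.projIcc (0 : ℝ) 1 zero_le_one ((((k j : ℕ) : ℝ) + 1) / 2 ^ n)) - c (Set.projIcc (0 : ℝ) 1 zero_le_one (((k j : ℕ) : ℝ) / 2 ^ n)))); let rep : Literature.Probability.RandomPlanarGeometry.CurveClass ℂ → Literature.Probability.RandomPlanarGeometry.Curve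 ℂ := fun x => (Literature.Probability.RandomPlanarGeometry.CurveClass.surjective_mk x).choose; ∀ (q : ℝ), 1 ≤ q → q < 2 → ∀ μ : MeasureTheory.Measure (Literature.Probability.RandomPlanarGeometry.CurveClass ℂ), Literature.Probability.RandomPlanarGeometry.IsSLELaw ((8 : NNReal) / 3) D μ → (∀ n : ℕ, ∫⁻ x, pv q (rep x) ^ (n : ℝ) ∂μ ≠ ⊤) → (∀ w : List (Fin 2), MeasureTheory.Integrable (fun x => sig w (rep x)) μ) → ∀ r : ℝ, 0 < r → Summable (fun n : ℕ => r ^ n * ⨆ w : {w : List (Fin 2) // w.length = n}, |∫ x, sig w.1 (rep x) ∂μ|)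

/-- name-keyed alias of the statement of `stub_determinacyOfRadius` (the registrar matches hypotheses of `MomentsIdentifySLE_of` by
these names). [folklore] -/
abbrev stub_determinacyOfRadius : Prop :=
  let pv : ℝ → Literature.Probability.RandomPlanarGeometry.Curve ℂ → ENNReal := fun p c => ⨆ π : ℕ × {u : ℕ → unitInterval // Monotone u}, ∑ i ∈ Finset.range π.1, edist (c (π.2.1 (i + 1))) (c (π.2.1 i)) ^ p; let sig : List (Fin 2) → Literature.Probability.RandomPlanarGeometry.Curve ℂ → ℝ := fun w c => limUnder Filter.atTop (fun n : ℕ => ∑ k ∈ (Finset.univ : Finset (Fin w.length → Fin (2 ^ n))).filter (fun k => StrictMono k), ∏ j : Fin w.length, (if w.get j = 0 then Complex.re else Complex.im) (c (Set.projIcc (0 : ℝ) 1 zero_le_one ((((k j : ℕ) : ℝ) + 1) / 2 ^ n)) - c (Set.projIcc (0 : ℝ) 1 zero_le_one (((k j : ℕ) : ℝ) / 2 ^ n)))); let rep : Literature.Probability.RandomPlanarGeometry.CurveClass ℂ → Literature.Probability.RandomPlanarGeometry.Curve ℂ := fun x => (Literature.Probability.RandomPlanarGeometry.CurveClass.surjective_mk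 x).choose; ∀ (p q : ℝ), 1 ≤ p → p < 2 → 1 ≤ q → q < 2 → ∀ μ ν : MeasureTheory.Measure (Literature.Probability.RandomPlanarGeometry.CurveClass ℂ), MeasureTheory.IsProbabilityMeasure μ → MeasureTheory.IsProbabilityMeasure ν → (∀ n : ℕ, ∫⁻ x, pv q (rep x) ^ (n : ℝ) ∂μ ≠ ⊤) → (∀ n : ℕ, ∫⁻ x, pv p (rep x) ^ (n : ℝ) ∂ν ≠ ⊤) → (∀ w : List (Fin 2), MeasureTheory.Integrable (fun x => sig w (rep x)) μ ∧ MeasureTheory.Integrable (fun x => sig w (rep x)) ν ∧ ∫ x, sig w (rep x) ∂ν = ∫ x, sig w (rep x) ∂μ) → (∀ r : ℝ, 0 < r → Summable (fun n : ℕ => r ^ n * ⨆ w : {w : List (Fin 2) // w.length = n}, |∫ x, sig w.1 (rep x) ∂μ|)) → ∀ (ws : List (List (Fin 2))) (F : BoundedContinuousFunction (Fin ws.length → ℝ) ℝ), ∫ x, F (fun i => sig (ws.get i) (rep x)) ∂ν = ∫ x, F (fun i => sig (ws.get i) (rep x)) ∂μ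

/-- name-keyed alias of the statement of `stub_coeffMeasurable` (the registrar matches hypotheses of `MomentsIdentifySLE_of` by
these names). [folklore] -/
abbrev stub_coeffMeasurable : Prop :=
  let pv : ℝ → Literature.Probability.RandomPlanarGeometry.Curve ℂ → ENNReal := fun p c => ⨆ π : ℕ × {u : ℕ → unitInterval // Monotone u}, ∑ i ∈ Finset.range π.1, edist (c (π.2.1 (i + 1))) (c (π.2.1 i)) ^ p; let sig : List (Fin 2) → Literature.Probability.RandomPlanarGeometry.Curve ℂ → ℝ := fun w c => limUnder Filter.atTop (fun n : ℕ => ∑ k ∈ (Finset.univ : Finset (Fin w.length → Fin (2 ^ n))).filter (fun k => StrictMono k), ∏ j : Fin w.length, (if w.get j = 0 then Complex.re else Complex.im) (c (Set.projIcc (0 : ℝ) 1 zero_le_one ((((k j : ℕ) : ℝ) + 1) / 2 ^ n)) - c (Set.projIcc (0 : ℝ) 1 zero_le_one (((k j : ℕ) : ℝ) / 2 ^ n)))); let rep : Literature.Probability.RandomPlanarGeometry.CurveClass ℂ → Literature.Probability.RandomPlanarGeometry.Curve ℂ := fun x => (Literature.Probability.RandomPlanarGeometry.CurveClass.surjective_mk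 x).choose; (∀ r : ℝ, 1 ≤ r → r < 2 → Measurable (fun x : Literature.Probability.RandomPlanarGeometry.CurveClass ℂ => pv r (rep x))) ∧ ∀ z : ℂ, MeasurableSet {x : Literature.Probability.RandomPlanarGeometry.CurveClass ℂ | x ∈ Literature.Probability.RandomPlanarGeometry.CurveClass.simple ∧ x.source = z ∧ ∃ r : ℝ, 1 ≤ r ∧ r < 2 ∧ pv r (rep x) ≠ ⊤} ∧ ∀ w : List (Fin 2), Measurable (Set.restrict {x : Literature.Probability.RandomPlanarGeometry.CurveClass ℂ | x ∈ Literature.Probability.RandomPlanarGeometry.CurveClass.simple ∧ x.source = z ∧ ∃ r : ℝ, 1 ≤ r ∧ r < 2 ∧ pv r (rep x) ≠ ⊤} (fun x => sig w (rep x)))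

/-- name-keyed alias of the statement of `stub_sigInjOn` (the registrar matches hypotheses of `MomentsIdentifySLE_of` by
these names). [folklore] -/
abbrev stub_sigInjOn : Prop :=
  let pv : ℝ → Literature.Probability.RandomPlanarGeometry.Curve ℂ → ENNReal := fun p c => ⨆ π : ℕ × {u : ℕ → unitInterval // Monotone u}, ∑ i ∈ Finset.range π.1, edist (c (π.2.1 (i + 1))) (c (π.2.1 i)) ^ p; let sig : List (Fin 2) → Literature.Probability.RandomPlanarGeometry.Curve ℂ → ℝ := fun w c => limUnder Filter.atTop (fun n : ℕ => ∑ k ∈ (Finset.univ : Finset (Fin w.length → Fin (2 ^ n))).filter (fun k => StrictMono k), ∏ j : Fin w.length, (if w.get j = 0 then Complex.re else Complex.im) (c (Set.projIcc (0 : ℝ) 1 zero_le_one ((((k j : ℕ) : ℝ) + 1) / 2 ^ n)) - c (Set.projIcc (0 : ℝ) 1 zero_le_one (((k j : ℕ) : ℝ) / 2 ^ n)))); let rep : Literature.Probability.RandomPlanarGeometry.CurveClass ℂ → Literature.Probability.RandomPlanarGeometry.Curve ℂ := fun x => (Literature.Probability.RandomPlanarGeometry.CurveClass.surjective_mk x).choose;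 ∀ z : ℂ, Set.InjOn (fun x : Literature.Probability.RandomPlanarGeometry.CurveClass ℂ => fun w : List (Fin 2) => sig w (rep x)) {x : Literature.Probability.RandomPlanarGeometry.CurveClass ℂ | x ∈ Literature.Probability.RandomPlanarGeometry.CurveClass.simple ∧ x.source = z ∧ ∃ r : ℝ, 1 ≤ r ∧ r < 2 ∧ pv r (rep x) ≠ ⊤}

/-- name-keyed alias of the statement of `stub_measure_eq_of_injOn` (the registrar matches hypotheses of `MomentsIdentifySLE_of` by
these names). [folklore] -/
abbrev stub_measure_eq_of_injOn : Prop :=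
  ∀ (f : List (Fin 2) → Literature.Probability.RandomPlanarGeometry.CurveClass ℂ → ℝ) (A : Set (Literature.Probability.RandomPlanarGeometry.CurveClass ℂ)), MeasurableSet A → (∀ w : List (Fin 2), Measurable (A.restrict (f w))) → Set.InjOn (fun x => fun w => f w x) A → ∀ μ ν : MeasureTheory.Measure (Literature.Probability.RandomPlanarGeometry.CurveClass ℂ), MeasureTheory.IsProbabilityMeasure μ → MeasureTheory.IsProbabilityMeasure ν → μ Aᶜ = 0 → ν Aᶜ = 0 → (∀ (ws : List (List (Fin 2))) (F : BoundedContinuousFunction (Fin ws.length → ℝ) ℝ), ∫ x, F (fun i => f (ws.get i) x) ∂ν = ∫ x, F (fun i => f (ws.get i) x) ∂μ) → ν = μ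

end Registered

/-- **Line `signature-moment-seam`.** The seven registered stubs imply the crux
`SAWExpectedSignature.MomentsIdentifySLE` (route decl, by name): pieces from stubs (§1), crux from pieces by the
split glue (proof of `Split.MomentsIdentifySLE_of_subs`, inlined: existence of the SLE(8/3) law of `D`,
`exists_isSLELaw_of_ne_eight`; piece 1 fed with the limits carried by `ν`; piece 2; piece 3; transport along `ν = μ`).
No sorry outside `stub_*`. [folklore] -/
theorem MomentsIdentifySLE_of (hα : Registered.stub_sleYoungRegular) (hβ : Registered.stub_valueIsSLE) (hρ : Registered.stub_expSigRadius) (hc : Registered.stub_determinacyOfRadius) (hM : Registered.stub_coeffMeasurable) (hI : Registered.stub_sigInjOn) (hT : Registered.stub_measure_eq_of_injOn) :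
    MomentsIdentifySLE := by
  have h1 := SigLimitIsSLE_of hα hβ
  have h2 := SLESigDeterminacy_of hρ hc
  have h3 := SimpleLawFromSigLaw_of hM hI hT
  intro D a b hab
  dsimp only
  intro p hp1 hp2 ν hν hmom hsimp hsrc hsig
  -- the chordal SLE(8/3) law `μ` of `D` exists (Rohde–Schramm Thm 5.1 / 7.1, proved in the tree)
  obtain ⟨μ, hμ⟩ :=
    Literature.Probability.RandomPlanarGeometry.exists_isSLELaw_of_ne_eight (κ := (8 : NNReal) / 3)
      (by positivity) (by norm_num) D
  -- piece 1, fed with the lattice limits carried by `ν` (hypothesis (iv)): `μ` is Young-regular with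
  -- exponent `q`, its signature coefficients are integrable and their expectations are those limits
  have h1' := h1 D a b hab
  dsimp only at h1'
  obtain ⟨q, hq1, hq2, hmomμ, hS⟩ := h1' μ hμ _ (fun w => (hsig w).2)
  -- piece 2: the joint laws of the signature coefficients under `ν` and `μ` agree
  have h2' := h2 D
  dsimp only at h2'
  have hlaw := h2' p q hp1 hp2 hq1 hq2 μ ν hμ hν hmomμ hmom
    (fun w => ⟨(hS w).1, (hsig w).1, (hS w).2.symm⟩)
  -- piece 3: a simple pinned finite-moment law with the SLE signature law is the SLE law
  have h3' := h3 D
  dsimp only at h3'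
  have hνμ : ν = μ := h3' p q hp1 hp2 hq1 hq2 μ ν hμ hν hmomμ hmom hsimp hsrc hlaw
  rw [hνμ]
  exact hμ

/-- Hypothesis-free form: the crux modulo the seven sorried stubs. -/
example : MomentsIdentifySLE :=
  MomentsIdentifySLE_of stub_sleYoungRegular stub_valueIsSLE stub_expSigRadius stub_determinacyOfRadius
    stub_coeffMeasurable stub_sigInjOn stub_measure_eq_of_injOn

end Summit.CriticalPhenomena.SAWScalingLimit.Cruxes.MomentsIdentifySLE.SignatureMomentSeam
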